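import Mathlib.Analysis.SpecialFunctions.PolarCoord
import Mathlib.Analysis.SpecialFunctions.Integrals.Basic
import Mathlib.MeasureTheory.Group.Measure
import Literature.MathematicalPhysics.StatisticalMechanics.HardDiscVirialProofs
import Literature.MathematicalPhysics.StatisticalMechanics.HardDiscVirialRingProofs
import Literature.MathematicalPhysics.StatisticalMechanics.HardDiscRingDiamondVolume
import HarnessLib

/-!
# Plane-geometry and measure glue for the fourth virial coefficient of hard discs

Auxiliary [folklore] results in `ℝ × ℝ` (Lebesgue measure `volume`) used by the computation of the
complete-star diagram of `B₄` for hard discs (`HardDiscVirial.lean`, fact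
`ClisbyMcCoy2004_B4_hardDiscs`; files `HardDiscVirialStarReduce.lean`, `HardDiscVirialStarLens.lean`),
complementing the lens lemmas of `HardDiscVirialProofs.lean` (namespace `HardDiscTriangleVolume`:
`volume_lens`, `volume_lensAt`) and the null-set / lens / circle lemmas of
`HardDiscVirialRingProofs.lean` (namespace `HardDiscB4Volume`: `prod_null_of_sections`,
`volume_circle_eq_zero`) and `HardDiscRingDiamondVolume.lean` (namespace `HardDiscRingVolume`), which
are imported and reused rather than restated:

* the thin lens `L = {|q| < 1, |q − (0,1)| < 1}` has area `A(1) = 2π/3 − √3/2 > 0`;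
* the rotation `q ↦ ((b q₁ − a q₂)/ρ, (a q₁ + b q₂)/ρ)`, `ρ = √(a²+b²) > 0`, preserves `volume`;
* the two halves `{q₁ ≤ 0}`, `{q₁ ≥ 0}` of `L` have diameter `≤ 1` (any two points of one closed
  half of the open lens are at distance `< 1`);
* the reflection `(x, y) ↦ (x, 1 − y)` preserves `volume` (a one-line consequence of Mathlib; the
  same statement exists in `BoltzmannB4HardSpheresProofs.lean`, whose import (all of Mathlib) is
  deliberately avoided here);
* `∫_{|p|<1} |p|⁴ dp = π/3` (an instance of `HardDiscRingVolume.lintegral_radial_ite`).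

No definitions and no named facts are introduced.
-/

noncomputable section

open _root_.MeasureTheory _root_.Set _root_.Real
open scoped ENNReal

namespace Literature.MathematicalPhysics.StatisticalMechanics

namespace HardDiscB4

open HardDiscTriangleVolume

/-! ### The thin lens -/

/-- The lens area at distance `1`: `A(1) = 2π/3 − √3/2`. [folklore] -/
theorem lensArea_one : 2 * arccos (1 / 2) - 1 * √(1 - 1 ^ 2 / 4) = 2 * π / 3 - √3 / 2 := by
  have h1 : arccos (1 / 2 : ℝ) = π / 3 := by
    rw [← cos_pi_div_three, arccos_cos (by linarith [pi_pos]) (by linarith [pi_pos])]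
  have h2 : √(1 - 1 ^ 2 / 4 : ℝ) = √3 / 2 := by
    rw [show (1 - 1 ^ 2 / 4 : ℝ) = 3 / 4 by norm_num, sqrt_div (by norm_num),
      show (4:ℝ) = 2 ^ 2 by norm_num, sqrt_sq (by norm_num)]
  rw [h1, h2]
  ring

/-- The thin lens `L = {q | |q| < 1, |q − (0,1)| < 1}` has area `2π/3 − √3/2`. [folklore] -/
theorem volume_thinLens :
    volume {q : ℝ × ℝ | q.1 ^ 2 + q.2 ^ 2 < 1 ∧ q.1 ^ 2 + (q.2 - 1) ^ 2 < 1} =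
      ENNReal.ofReal (2 * π / 3 - √3 / 2) := by
  rw [(volume_lens (ρ := 1) zero_le_one le_rfl).1, lensArea_one]

/-- `2π/3 − √3/2 > 0`. [folklore] -/
theorem lensArea_one_pos : 0 < 2 * π / 3 - √3 / 2 := by
  have h3 : √3 < 2 := by
    rw [show (2:ℝ) = √4 by rw [show (4:ℝ) = 2 ^ 2 by norm_num, sqrt_sq (by norm_num)]]
    exact sqrt_lt_sqrt (by norm_num) (by norm_num)
  linarith [two_le_pi]

/-! ### Rotations preserve Lebesgue measure -/

/-- The rotation `q ↦ ((b q₁ − a q₂)/ρ, (a q₁ + b q₂)/ρ)`, `ρ = √(a² + b²) > 0`, preserves the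
Lebesgue measure of `ℝ × ℝ`: a linear equivalence rescales the additive Haar measure `volume` by a
constant (`Measure.addHaar_preimage_linearEquiv`), and the constant is `1` because the unit disc is
pulled back to itself. [folklore] -/
theorem measurePreserving_rot {a b : ℝ} (hab : 0 < a ^ 2 + b ^ 2) :
    MeasurePreserving (fun q : ℝ × ℝ =>
      ((b * q.1 - a * q.2) / √(a ^ 2 + b ^ 2), (a * q.1 + b * q.2) / √(a ^ 2 + b ^ 2)))
      volume volume := by
  set ρ := √(a ^ 2 + b ^ 2) with hρ_def
  have hρsq : ρ ^ 2 = a ^ 2 + b ^ 2 := sq_sqrt hab.le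
  have hρ0 : 0 < ρ := sqrt_pos.mpr hab
  have h := hρsq.symm
  have hρ : ρ ≠ 0 := hρ0.ne'
  let M : (ℝ × ℝ) ≃ₗ[ℝ] (ℝ × ℝ) :=
    { toFun := fun q => ((b * q.1 - a * q.2) / ρ, (a * q.1 + b * q.2) / ρ)
      invFun := fun u => ((b * u.1 + a * u.2) / ρ, (-a * u.1 + b * u.2) / ρ)
      map_add' := fun x y => by
        ext <;> simp only [Prod.fst_add, Prod.snd_add] <;> ring
      map_smul' := fun c x => by
        ext <;> simp only [Prod.smul_fst, Prod.smul_snd, smul_eq_mul, RingHom.id_apply] <;> ring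
      left_inv := fun q => by
        ext
        · simp only
          field_simp
          linear_combination q.1 * h
        · simp only
          field_simp
          linear_combination q.2 * h
      right_inv := fun u => by
        ext
        · simp only
          field_simp
          linear_combination u.1 * h
        · simp only
          field_simp
          linear_combination u.2 * h }
  have hMq : ∀ q : ℝ × ℝ, M q = ((b * q.1 - a * q.2) / ρ, (a * q.1 + b * q.2) / ρ) :=
    fun q => rfl
  have hnorm : ∀ q : ℝ × ℝ, (M q).1 ^ 2 + (M q).2 ^ 2 = q.1 ^ 2 + q.2 ^ 2 := by
    intro q
    rw [hMq]
    field_simp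
    linear_combination -(q.1 ^ 2 + q.2 ^ 2) * hρsq
  have hD : (M : ℝ × ℝ → ℝ × ℝ) ⁻¹' {q | q.1 ^ 2 + q.2 ^ 2 < 1} =
      {q | q.1 ^ 2 + q.2 ^ 2 < 1} := by
    ext q
    simp only [mem_preimage, mem_setOf_eq, hnorm q]
  have hκ : ENNReal.ofReal |LinearMap.det (M.symm : ℝ × ℝ →ₗ[ℝ] ℝ × ℝ)| = 1 := by
    have key := Measure.addHaar_preimage_linearEquiv volume M
      {q : ℝ × ℝ | q.1 ^ 2 + q.2 ^ 2 < 1}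
    rw [hD] at key
    nth_rewrite 1 [← one_mul (volume {q : ℝ × ℝ | q.1 ^ 2 + q.2 ^ 2 < 1})] at key
    exact ((ENNReal.mul_left_inj volume_disc_ne_zero volume_disc_ne_top).mp key).symm
  refine ⟨by fun_prop, ?_⟩
  ext s hs
  rw [Measure.map_apply (by fun_prop) hs]
  change volume ((M : ℝ × ℝ → ℝ × ℝ) ⁻¹' s) = volume s
  rw [Measure.addHaar_preimage_linearEquiv, hκ, one_mul]

/-! ### The two halves of the thin lens have diameter at most `1` -/

/-- Two points of the open thin lens `{|q| < 1, |q − (0,1)| < 1}` lying (weakly) on the same side of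
the axis `{q₁ = 0}` are at distance `< 1` (each closed half lies in a Reuleaux triangle of width
`1`). [folklore] -/
theorem thinLens_sameSide_dist_lt {q s : ℝ × ℝ} (hq : q.1 ^ 2 + q.2 ^ 2 < 1)
    (hq' : q.1 ^ 2 + (q.2 - 1) ^ 2 < 1) (hs : s.1 ^ 2 + s.2 ^ 2 < 1)
    (hs' : s.1 ^ 2 + (s.2 - 1) ^ 2 < 1) (hside : 0 ≤ q.1 * s.1) :
    (q.1 - s.1) ^ 2 + (q.2 - s.2) ^ 2 < 1 := by
  -- `(q₁ − s₁)² ≤ max(q₁², s₁²)` for `q₁ s₁ ≥ 0`; then compare with `|q|², |q − e|², |s|², |s − e|²`.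
  have hq2 : 0 < q.2 := by nlinarith [sq_nonneg q.1]
  have hs2 : 0 < s.2 := by nlinarith [sq_nonneg s.1]
  have hq2' : q.2 < 1 := by nlinarith [sq_nonneg q.1]
  have hs2' : s.2 < 1 := by nlinarith [sq_nonneg s.1]
  rcases le_total (s.1 ^ 2) (q.1 ^ 2) with h1 | h1
  · have hx : (q.1 - s.1) ^ 2 ≤ q.1 ^ 2 := by nlinarith
    rcases le_total q.2 s.2 with h2 | h2
    · have hy : (q.2 - s.2) ^ 2 < (q.2 - 1) ^ 2 := by nlinarith
      linarith
    · have hy : (q.2 - s.2) ^ 2 < q.2 ^ 2 := by nlinarith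
      linarith
  · have hx : (q.1 - s.1) ^ 2 ≤ s.1 ^ 2 := by nlinarith
    rcases le_total s.2 q.2 with h2 | h2
    · have hy : (q.2 - s.2) ^ 2 < (s.2 - 1) ^ 2 := by nlinarith
      linarith
    · have hy : (q.2 - s.2) ^ 2 < s.2 ^ 2 := by nlinarith
      linarith

/-! ### A reflection -/

/-- The reflection `(x, y) ↦ (x, 1 − y)` preserves Lebesgue measure on `ℝ × ℝ` (also stated in
`BoltzmannB4HardSpheresProofs.lean`, not imported here to keep the import closure small).
[folklore] -/
theorem measurePreserving_reflect_snd :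
    MeasurePreserving (fun q : ℝ × ℝ => (q.1, 1 - q.2)) volume volume :=
  (MeasurePreserving.id volume).prod (Measure.measurePreserving_sub_left (volume : Measure ℝ) 1)

/-! ### The fourth moment of the unit disc -/

/-- `∫⁻_{|p| < 1} |p|⁴ dp = π/3` (as `∫⁻ p, 𝟙(|p|²<1)·ofReal((|p|²)²) = ofReal(π/3)`), an instance of
`HardDiscRingVolume.lintegral_radial_ite` (polar coordinates) with `f = (·)⁴`, `c = 1`. [folklore] -/
theorem lintegral_normSq_sq_disc :
    ∫⁻ p : ℝ × ℝ, (if p.1 ^ 2 + p.2 ^ 2 < 1 then ENNReal.ofReal ((p.1 ^ 2 + p.2 ^ 2) ^ 2) else 0)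
      = ENNReal.ofReal (π / 3) := by
  have h := HardDiscRingVolume.lintegral_radial_ite (c := 1) zero_lt_one (f := fun r : ℝ => r ^ 4)
    (by fun_prop) (fun r _ => by positivity)
  simp only [one_pow] at h
  have hfun : (fun p : ℝ × ℝ => (if p.1 ^ 2 + p.2 ^ 2 < 1 then
      ENNReal.ofReal ((p.1 ^ 2 + p.2 ^ 2) ^ 2) else 0)) =
      fun p => (if p.1 ^ 2 + p.2 ^ 2 < 1 then ENNReal.ofReal (√(p.1 ^ 2 + p.2 ^ 2) ^ 4) else 0) := by
    funext p
    have h0 : 0 ≤ p.1 ^ 2 + p.2 ^ 2 := by positivity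
    rw [show (4:ℕ) = 2 * 2 by norm_num, pow_mul, sq_sqrt h0]
  have hI : ∫ r in (0:ℝ)..1, r * r ^ 4 = 1 / 6 := by
    rw [show (fun r : ℝ => r * r ^ 4) = fun r => r ^ 5 by funext r; ring, integral_pow]
    norm_num
  rw [hfun, h, hI, ← ENNReal.ofReal_mul (by positivity)]
  congr 1
  ring

end HardDiscB4

end Literature.MathematicalPhysics.StatisticalMechanics

end
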